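import Summits.MatrixMultiplication.MatrixMultiplication.Theorems.AbelianSTPPCensusShapeCertVQSearchS
import Summits.MatrixMultiplication.MatrixMultiplication.Theorems.AbelianSTPPCensusShapeCertVQSearchE

/-!
# Abelian STPP census — soundness of `ShapeCertVQ.checkQS`, part 3: how the path segments assemble

Cell mm-stpp, rung F-M1; successor kernel item VQ-CERT (T_E beyond 337 under vQ := vP ∧ E3⁺) in support of the closed crux item
stmt-MatrixMultiplication-19191; seat mm-stpp-vp-p2 (gen 2).  Pure bookkeeping about the Boolean search of `…DefsS` (after g1's
`…ShapeCertVQSearchP`, for the blocked pool):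
* `segOutS_append` / `segInS_append` — consecutive outer (block) / inner (member) segments of one node concatenate;
  `loopS_of_segOutS` — an outer segment longer than the pool gives the walk (`innerS` is monotone in its continuation, `innerS_mono`);
  `segInS_eq_innerS` — an inner segment longer than the block is the block's walk;
* `dfsS_of_nodeOutS` — one level of `dfsS` from the node-level decision and a long enough outer segment;
* `pathOutS_append`, `pathInS_append`, `pathOK_of_out` (outer segments covering the pool give the node, `PathOKS`),
  `pathOut_single_of_in` (inner segments covering block `i` give the one-block outer segment), `pathIn_single_of_child` (a node gives
  the one-member inner segment of its parent, given any evaluated sibling inner segment vouching for the parent's node-level decision),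
  `checkQS_of_pathOK_nil` (the root node is `checkQS M`).
So an order is certified by kernel-evaluating a tree of `pathOutS` / `pathInS` facts and folding them with these lemmas (seat generator).
-/

set_option linter.dupNamespace false -- `MatrixMultiplication.MatrixMultiplication` (summit = problem, D-0017)
set_option autoImplicit false

namespace Summit.MatrixMultiplication.MatrixMultiplication.Theorems.ShapeCertVQ

open ShapeCert ShapeCertVP

section segs
variable {M : ℕ} {rec : List Sh → List (List Sh) → Bool} {fam : List Sh} {A : Agg} {ra rb rc vl g0 q : ℕ} {sel : B8 → ℕ}
  {mdk lb1 lc : ℕ} {cl : Bool}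

/-- `innerS` is monotone in its continuation: a block that passes with continuation `true` passes with any true continuation -/
theorem innerS_mono {k : Bool} {bs : List (List Sh)} (hk : k = true) : ∀ b : List Sh,
    innerS M rec fam A ra rb rc vl g0 q sel mdk lb1 true bs b = true → innerS M rec fam A ra rb rc vl g0 q sel mdk lb1 k bs b = true
  | [], _ => by rw [innerS]; exact hk
  | t :: r, h => by
    rw [innerS] at h ⊢
    by_cases hbr : t.lev < lb1
    · rw [if_pos hbr]
    · rw [if_neg hbr] at h ⊢
      by_cases hsk : skipS t ra rb rc vl q = true
      · rw [if_pos hsk] at h ⊢; exact innerS_mono hk r h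
      · rw [if_neg hsk] at h ⊢
        rw [Bool.and_eq_true] at h ⊢
        exact ⟨h.1, innerS_mono hk r h.2⟩

/-- consecutive outer segments concatenate -/
theorem segOutS_append : ∀ (n m : ℕ) (B : List (List Sh)),
    segOutS M rec fam A ra rb rc vl g0 q sel mdk lb1 lc cl n B = true →
    segOutS M rec fam A ra rb rc vl g0 q sel mdk lb1 lc cl m (B.drop n) = true →
    segOutS M rec fam A ra rb rc vl g0 q sel mdk lb1 lc cl (n + m) B = true
  | 0, m, B, _, h2 => by simpa using h2
  | n + 1, 0, [], h1, _ => by simpa [segOutS] using h1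
  | n + 1, m + 1, [], h1, _ => by
    rw [show n + 1 + (m + 1) = (n + m + 1) + 1 by omega, segOutS]; rw [segOutS] at h1; exact h1
  | n + 1, m, b :: bs, h1, h2 => by
    rw [Nat.add_right_comm]
    rw [List.drop_succ_cons] at h2
    cases b with
    | nil =>
      rw [segOutS] at h1 ⊢
      exact segOutS_append n m bs h1 h2
    | cons t r =>
      rw [segOutS] at h1 ⊢
      by_cases hbr : t.lev < lb1
      · rw [if_pos hbr]
      · rw [if_neg hbr] at h1 ⊢
        by_cases hcap : lc ≤ t.lev
        · rw [if_pos hcap] at h1 ⊢; exact segOutS_append n m bs h1 h2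
        · rw [if_neg hcap] at h1 ⊢
          rw [Bool.and_eq_true] at h1 ⊢
          exact ⟨h1.1, segOutS_append n m bs h1.2 h2⟩

/-- an outer segment longer than the pool gives the whole walk -/
theorem loopS_of_segOutS : ∀ (n : ℕ) (B : List (List Sh)), B.length < n →
    segOutS M rec fam A ra rb rc vl g0 q sel mdk lb1 lc cl n B = true →
    loopS M rec fam A ra rb rc vl g0 q sel mdk lb1 lc cl B = true
  | 0, _, h, _ => absurd h (Nat.not_lt_zero _)
  | n + 1, [], _, h => by rw [segOutS] at h; rw [loopS]; exact h
  | n + 1, b :: bs, hl, h => by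
    have hn : bs.length < n := by simpa using hl
    cases b with
    | nil =>
      rw [segOutS] at h; rw [loopS]
      exact loopS_of_segOutS n bs hn h
    | cons t r =>
      rw [segOutS] at h; rw [loopS]
      by_cases hbr : t.lev < lb1
      · rw [if_pos hbr]
      · rw [if_neg hbr] at h ⊢
        by_cases hcap : lc ≤ t.lev
        · rw [if_pos hcap] at h ⊢; exact loopS_of_segOutS n bs hn h
        · rw [if_neg hcap] at h ⊢
          rw [Bool.and_eq_true] at h
          exact innerS_mono (loopS_of_segOutS n bs hn h.2) _ h.1

/-- consecutive inner segments concatenate -/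
theorem segInS_append {bs : List (List Sh)} : ∀ (n m : ℕ) (b : List Sh),
    segInS M rec fam A ra rb rc vl g0 q sel mdk lb1 bs n b = true →
    segInS M rec fam A ra rb rc vl g0 q sel mdk lb1 bs m (b.drop n) = true →
    segInS M rec fam A ra rb rc vl g0 q sel mdk lb1 bs (n + m) b = true
  | 0, m, b, _, h2 => by simpa using h2
  | n + 1, 0, [], _, _ => by simp [segInS]
  | n + 1, m + 1, [], _, _ => by rw [show n + 1 + (m + 1) = (n + m + 1) + 1 by omega, segInS]
  | n + 1, m, t :: r, h1, h2 => by
    rw [Nat.add_right_comm, segInS]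
    rw [segInS] at h1
    rw [List.drop_succ_cons] at h2
    by_cases hbr : t.lev < lb1
    · rw [if_pos hbr]
    · rw [if_neg hbr] at h1 ⊢
      by_cases hsk : skipS t ra rb rc vl q = true
      · rw [if_pos hsk] at h1 ⊢; exact segInS_append n m r h1 h2
      · rw [if_neg hsk] at h1 ⊢
        rw [Bool.and_eq_true] at h1 ⊢
        exact ⟨h1.1, segInS_append n m r h1.2 h2⟩

/-- an inner segment longer than the block is the block's walk (continuation `true`) -/
theorem segInS_eq_innerS {bs : List (List Sh)} : ∀ (n : ℕ) (b : List Sh), b.length < n →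
    segInS M rec fam A ra rb rc vl g0 q sel mdk lb1 bs n b = innerS M rec fam A ra rb rc vl g0 q sel mdk lb1 true bs b
  | 0, _, h => absurd h (Nat.not_lt_zero _)
  | n + 1, [], _ => by rw [segInS, innerS]
  | n + 1, t :: r, h => by
    rw [segInS, innerS]
    have ih := segInS_eq_innerS (bs := bs) n r (by simpa using h)
    simp only [ih]

end segs

section node
variable {M : ℕ}

/-- **one level of the search from its pieces**: if the node-level decision is open and an outer segment longer than the pool passes,
the node passes -/
theorem dfsS_of_nodeOutS (fuel : ℕ) (fam : List Sh) (B : List (List Sh)) {n : ℕ} (hn : B.length < n)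
    (hdec : nodeDecQE M fam = none) (h : nodeOutS M (dfsS M fuel) fam n B = true) : dfsS M (fuel + 1) fam B = true := by
  rw [dfsS]
  unfold nodeDecQE at hdec
  unfold nodeOutS at h
  simp only [Agg.force_eq, seqN_eq] at hdec h ⊢
  by_cases h1 : killE M (aggOf M fam) fam = true
  · rw [if_pos h1] at hdec; exact absurd hdec (by simp)
  rw [if_neg h1] at hdec ⊢
  by_cases h2 : M * D < (aggOf M fam).gs
  · rw [if_pos h2] at hdec; exact absurd hdec (by simp)
  rw [if_neg h2] at hdec ⊢
  by_cases h3 : (aggOf M fam).dead M = true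
  · rw [if_pos h3] at hdec; exact absurd hdec (by simp)
  rw [if_neg h3] at hdec ⊢
  by_cases h4 : (budsOf M (aggOf M fam) fam).tailEmpty = true
  · rw [if_pos h4] at hdec; exact absurd hdec (by simp)
  rw [if_neg h4] at hdec ⊢
  by_cases h5 : ((gnodeQ (headLevQ fam) (budsOf M (aggOf M fam) fam)).ok &&
      decide ((aggOf M fam).gs * K + (gnodeQ (headLevQ fam) (budsOf M (aggOf M fam) fam)).bud *
        (tabGQ (headLevQ fam)).get (gnodeQ (headLevQ fam) (budsOf M (aggOf M fam) fam)).idx ≤ M * D * K)) = true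
  · rw [if_pos h5] at hdec; exact absurd hdec (by simp)
  rw [if_neg h5]
  exact loopS_of_segOutS n B hn h

/-- a decided node -/
theorem dfsS_of_nodeDec (fuel : ℕ) (fam : List Sh) (B : List (List Sh)) (hdec : nodeDecQE M fam = some true) :
    dfsS M (fuel + 1) fam B = true := by
  rw [dfsS]
  unfold nodeDecQE at hdec
  simp only [Agg.force_eq, seqN_eq] at hdec ⊢
  by_cases h1 : killE M (aggOf M fam) fam = true
  · rw [if_pos h1]
  rw [if_neg h1] at hdec ⊢
  by_cases h2 : M * D < (aggOf M fam).gs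
  · rw [if_pos h2] at hdec; exact absurd hdec (by simp)
  rw [if_neg h2] at hdec ⊢
  by_cases h3 : (aggOf M fam).dead M = true
  · rw [if_pos h3]
  rw [if_neg h3] at hdec ⊢
  by_cases h4 : (budsOf M (aggOf M fam) fam).tailEmpty = true
  · rw [if_pos h4] at hdec ⊢; simpa using hdec
  rw [if_neg h4] at hdec ⊢
  by_cases h5 : ((gnodeQ (headLevQ fam) (budsOf M (aggOf M fam) fam)).ok &&
      decide ((aggOf M fam).gs * K + (gnodeQ (headLevQ fam) (budsOf M (aggOf M fam) fam)).bud *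
        (tabGQ (headLevQ fam)).get (gnodeQ (headLevQ fam) (budsOf M (aggOf M fam) fam)).idx ≤ M * D * K)) = true
  · rw [if_pos h5]
  rw [if_neg h5] at hdec; exact absurd hdec (by simp)

/-- every block of every pool along a path has fewer than `9999` members (pools are sub-blocks and suffixes of `candBQ M`) -/
theorem pathNodeS_block_lt (M : ℕ) : ∀ (path : List (ℕ × ℕ)), ∀ b ∈ (pathNodeS M path).2, b.length < 9999
  | [] => by
    intro b hb
    simp only [pathNodeS] at hb
    have h1 : b.length ≤ (candBQ M).flatten.length := (List.sublist_flatten_of_mem hb).length_le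
    rw [candBQ_flatten] at h1
    exact lt_of_le_of_lt (h1.trans (candQ_length_le M)) (by norm_num)
  | (i, j) :: ks => by
    intro b' hb'
    have ih := pathNodeS_block_lt M ks
    rw [pathNodeS] at hb'
    cases hd : ((pathNodeS M ks).2).drop i with
    | nil => rw [hd] at hb'; simp at hb'
    | cons b bs =>
      rw [hd] at hb'
      have hsub : ∀ x ∈ b :: bs, x ∈ (pathNodeS M ks).2 := fun x hx => by
        rw [← hd] at hx; exact List.mem_of_mem_drop hx
      cases hj : b.drop j with
      | nil =>
        simp only [hj] at hb'
        exact ih b' (hsub b' (List.mem_cons_of_mem _ hb'))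
      | cons t r =>
        simp only [hj, List.mem_cons] at hb'
        rcases hb' with rfl | hb'
        · have h1 : (t :: r).length ≤ b.length := by rw [← hj, List.length_drop]; omega
          exact lt_of_le_of_lt h1 (ih b (hsub b (by simp)))
        · exact ih b' (hsub b' (List.mem_cons_of_mem _ hb'))

end node

section paths
variable {M : ℕ}

/-- **consecutive outer segments of one node concatenate** -/
theorem pathOutS_append {path : List (ℕ × ℕ)} {i n m : ℕ} (h1 : pathOutS M path i n = true)
    (h2 : pathOutS M path (i + n) m = true) : pathOutS M path i (n + m) = true := by
  unfold pathOutS at h1 h2 ⊢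
  cases hdec : nodeDecQE M (pathNodeS M path).1 with
  | some v => simpa [hdec] using h1
  | none =>
    simp only [hdec] at h1 h2 ⊢
    unfold nodeOutS at h1 h2 ⊢
    simp only [Agg.force_eq, seqN_eq] at h1 h2 ⊢
    rw [← List.drop_drop] at h2
    exact segOutS_append n m _ h1 h2

/-- **outer segments covering the whole pool of a node give the node** -/
theorem pathOK_of_out {path : List (ℕ × ℕ)} {n : ℕ} (h : pathOutS M path 0 n = true) (hn : ((pathNodeS M path).2).length < n)
    (hd : path.length ≤ M + 1) : PathOKS M path := by
  unfold PathOKS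
  rw [show M + 2 - path.length = (M + 1 - path.length) + 1 by omega]
  unfold pathOutS at h
  rw [List.drop_zero] at h
  cases hdec : nodeDecQE M (pathNodeS M path).1 with
  | some v =>
    simp only [hdec] at h
    subst h
    exact dfsS_of_nodeDec _ _ _ hdec
  | none =>
    simp only [hdec] at h
    exact dfsS_of_nodeOutS _ _ _ hn hdec h

/-- **consecutive inner segments of one block concatenate** -/
theorem pathInS_append {path : List (ℕ × ℕ)} {i j n m : ℕ} (h1 : pathInS M path i j n = true)
    (h2 : pathInS M path i (j + n) m = true) : pathInS M path i j (n + m) = true := by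
  unfold pathInS at h1 h2 ⊢
  cases hdec : nodeDecQE M (pathNodeS M path).1 with
  | some v => simpa [hdec] using h1
  | none =>
    simp only [hdec] at h1 h2 ⊢
    cases hdi : ((pathNodeS M path).2).drop i with
    | nil => simp
    | cons b bs =>
      simp only [hdi] at h1 h2
      dsimp only
      unfold nodeInS at h1 h2 ⊢
      simp only [Agg.force_eq, seqN_eq] at h1 h2 ⊢
      rw [← List.drop_drop] at h2
      exact segInS_append n m _ h1 h2

/-- **inner segments covering block `i` give the one-block outer segment** (`i` a block index of the pool, the segments reaching
past `9999` members) -/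
theorem pathOut_single_of_in {path : List (ℕ × ℕ)} {i n : ℕ} (h : pathInS M path i 0 n = true)
    (hi : i < ((pathNodeS M path).2).length) (hn : 9999 ≤ n) : pathOutS M path i 1 = true := by
  unfold pathInS at h
  unfold pathOutS
  cases hdec : nodeDecQE M (pathNodeS M path).1 with
  | some v => simpa [hdec] using h
  | none =>
    simp only [hdec] at h ⊢
    cases hdi : ((pathNodeS M path).2).drop i with
    | nil =>
      exfalso
      have := List.drop_eq_nil_iff.mp hdi
      omega
    | cons b bs =>
      simp only [hdi, List.drop_zero] at h
      have hb : b.length < n :=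
        lt_of_lt_of_le (pathNodeS_block_lt M path b (List.mem_of_mem_drop (by rw [hdi]; simp))) hn
      unfold nodeOutS
      unfold nodeInS at h
      simp only [Agg.force_eq, seqN_eq] at h ⊢
      cases b with
      | nil => rw [segOutS, segOutS]
      | cons t r =>
        rw [segOutS]
        split_ifs with hbr hcap
        · rfl
        · rw [segOutS]
        · rw [segOutS, Bool.and_true, ← segInS_eq_innerS n _ hb]
          exact h

/-- **a node gives the one-member inner segment of its parent** (an evaluated sibling inner segment of the same node vouches for the
parent's node-level decision) -/
theorem pathIn_single_of_child {path : List (ℕ × ℕ)} {i j j' m : ℕ} (hsib : pathInS M path i j' m = true)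
    (hchild : PathOKS M ((i, j) :: path)) (hd : path.length ≤ M) : pathInS M path i j 1 = true := by
  unfold PathOKS at hchild
  have hfuel : M + 2 - ((i, j) :: path).length = (M - path.length) + 1 := by simp only [List.length_cons]; omega
  rw [hfuel] at hchild
  unfold pathInS at hsib ⊢
  cases hdec : nodeDecQE M (pathNodeS M path).1 with
  | some v => simpa [hdec] using hsib
  | none =>
    simp only [hdec] at hsib ⊢
    have hrec : M + 1 - path.length = (M - path.length) + 1 := by omega
    cases hdi : ((pathNodeS M path).2).drop i with
    | nil => simp
    | cons b bs =>
      dsimp only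
      rw [hrec]
      cases hdj : b.drop j with
      | nil =>
        unfold nodeInS
        simp only [Agg.force_eq, seqN_eq]
        rw [segInS]
      | cons t r =>
        have hnode : pathNodeS M ((i, j) :: path) = (t :: (pathNodeS M path).1, (t :: r) :: bs) := by
          rw [pathNodeS, hdi]; simp only; rw [hdj]
        rw [hnode] at hchild
        simp only at hchild
        unfold nodeInS
        simp only [Agg.force_eq, seqN_eq]
        rw [segInS]
        split_ifs with hbr hsk
        · rfl
        · rw [segInS]
        · rw [segInS, Bool.and_true]
          unfold stepS
          simp only [Agg.force_eq, seqN_eq]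
          split_ifs <;> first | rfl | exact hchild

/-- **the root node is the certificate** -/
theorem checkQS_of_pathOK_nil (h : PathOKS M []) : checkQS M = true := by
  unfold PathOKS at h; simpa [pathNodeS, checkQS] using h

/-- every pool along a path has fewer than `9999` blocks... in fact at most `47` (they are suffixes of sub-blocks of `candBQ M`) -/
theorem pathNodeS_blocks_le (M : ℕ) : ∀ path : List (ℕ × ℕ), ((pathNodeS M path).2).length ≤ 47
  | [] => by simp [pathNodeS, candBQ, levelsQ]
  | (i, j) :: ks => by
    have ih := pathNodeS_blocks_le M ks
    rw [pathNodeS]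
    cases hd : ((pathNodeS M ks).2).drop i with
    | nil => simp
    | cons b bs =>
      simp only
      have hl : (b :: bs).length = ((pathNodeS M ks).2).length - i := by rw [← hd, List.length_drop]
      simp only [List.length_cons] at hl
      cases hj : b.drop j with
      | nil => dsimp only; omega
      | cons t r => simp only [List.length_cons]; omega

end paths

end Summit.MatrixMultiplication.MatrixMultiplication.Theorems.ShapeCertVQ
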